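import Summits.CriticalPhenomena.PercolationContinuityZ3.Theorems.PercNearOneGluingAdditiveGluingGoodStep24Glue
import HarnessLib

/-! # Crux `PercNearOneGluing.AdditiveGluing` (stmt-CriticalPhenomena-4576), line `peel` (skeleton v7, whole-block
# route), stub `stub_wholeBlockPockets_c5` — the whole-block σ-identity P (the dead-pocket sum of a glued block
# through its layer)

Support file (`--supports stmt-CriticalPhenomena-4576`); no definitions, no named facts.

`μ_{u/S} = prodBernoulli (u/S)` is bond percolation on `Fin n` with the whole block `S` glued (`(u/S) e = 1` on the
non-loop pairs inside `S`, `= u e` otherwise), relays `A ∋ b` with `S ∩ A = ∅`; for a finite set `O` of vertices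
write `K_O(ω) = ⋃_{v ∈ O} C(v)` (the vertices joined to `O`), so that `{K_O = W}` is the event
`{ω | ∀ z, z ∈ W ↔ ω ∈ ⋃ v ∈ O, {v ↔ z}}`.  The identity proved here is the law of total probability over the LAYER of
`S`: on the layer event `L_N = {the outside vertices joined to S by an open pair are exactly N}` and the conull clique
event (all non-loop pairs inside `S` open) one has `K_S(ω) = K_N(Ψ_N ω) ∪ S` with
`Ψ_N ω = {e ∈ ω | e avoids S} ∪ {non-loop pairs inside N}` (the stars of `S` deleted, `N` glued; `stub_sigmaGeometry`
with `O = S`), the law of `Ψ_N` on `L_N` is `μ_{q_N}` with `q_N = ` (`u` with every star of `S` killed and `N` glued)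
(`stub_sigmaLaw` with `O = S`), the pockets correspond by `W ↦ W ∖ S`, and on a pocket `W' ⊇ N` of positive mass the
worst-selection factors agree, `μ_{u/S}(a ↔ b in (W' ∪ S)ᶜ) = μ_{q_N}(a ↔ b in W'ᶜ)` (the event only sees pairs
avoiding `W' ∪ S`, where `u/S = q_N`, and under `q_N` the isolated vertices of `S` may be added to the forbidden set for
free).  Hence
`Σ_{W ∩ A = ∅} μ_{u/S}(K_S = W) · min_A μ_{u/S}(· ↔ b in Wᶜ)`
`  = Σ_N μ_{u/S}(L_N) · Σ_{W' ∩ A = ∅} μ_{q_N}(K_N = W') · min_A μ_{q_N}(· ↔ b in W'ᶜ)`.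
This is the block analogue of `stub_bystanderPockets_c5` (hub `{x}` → `S`).
[cite: KozmaNitzan2024, §3.2 pp. 13–14 (the `σ_B`-decomposition)]
-/

namespace Summit.CriticalPhenomena.PercolationContinuityZ3.Theorems

open MeasureTheory Set
open Literature.Probability.LatticeModels (prodBernoulli)
open Literature.Probability.Percolation (BondConfig openConn openConnIn openGraph)
open scoped BigOperators Classical

noncomputable section

section WholeBlockPockets

open Literature.Probability.LatticeModels Literature.Probability.Percolation

variable {n : ℕ}

/-- A block-cluster event `{K_O = W}` with `O ⊄ W` is EMPTY (every vertex of the block lies in its cluster).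
[folklore] -/
theorem wbP_pocket_eq_empty (O W : Finset (Fin n)) (hOW : ¬ O ⊆ W) :
    {ω : BondConfig (Fin n) | ∀ z : Fin n, (z ∈ W ↔ ω ∈ ⋃ v ∈ O, openConn v z)} = ∅ := by
  refine Set.eq_empty_of_forall_notMem fun ω hω => hOW fun t ht => ?_
  refine (hω t).2 ?_
  simp only [Set.mem_iUnion, exists_prop]
  exact ⟨t, ht, SimpleGraph.Reachable.refl _⟩

/-- **Geometry on a layer of the block `S`.**  If every non-loop pair inside `S` is open and the outside vertices
joined to `S` by an open pair are exactly `N`, then for `W ∩ S = ∅`: the vertices joined to `S` in `ω` are exactly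
`W ∪ S` iff the vertices joined to `N` in `Ψ_N ω = {e ∈ ω | e avoids S} ∪ {non-loop pairs inside N}` are exactly `W`
(`stub_sigmaGeometry` with `O = S`; the vertices of `S` are isolated in `Ψ_N ω`). [cite: KozmaNitzan2024, §3.2 p. 14] -/
theorem wbP_geometry (S N W : Finset (Fin n)) (hWS : Disjoint W S) (ω : BondConfig (Fin n))
    (hL : ∀ y : Fin n, y ∈ N ↔ (y ∉ S ∧ ∃ o ∈ S, s(o, y) ∈ ω))
    (hclique : ∀ o ∈ S, ∀ o' ∈ S, o ≠ o' → s(o, o') ∈ ω) :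
    (∀ z : Fin n, (z ∈ W ∪ S ↔ ω ∈ ⋃ v ∈ S, openConn v z)) ↔
      ∀ z : Fin n, (z ∈ W ↔
        ({e | e ∈ ω ∧ ∀ y ∈ e, y ∉ S} ∪ {e | (∀ y ∈ e, y ∈ N) ∧ ¬ e.IsDiag} :
            BondConfig (Fin n)) ∈ ⋃ v ∈ N, openConn v z) := by
  have hNS : ∀ y ∈ N, y ∉ S := fun y hy => ((hL y).1 hy).1
  obtain ⟨h1, -⟩ := stub_sigmaGeometry n S N ω hL hclique
  -- no pair at a vertex of `S` is open in `Ψ_N ω`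
  have hstar : ∀ o ∈ S, ∀ y : Fin n, s(o, y) ∉ ({e | e ∈ ω ∧ ∀ y ∈ e, y ∉ S} ∪
      {e | (∀ y ∈ e, y ∈ N) ∧ ¬ e.IsDiag} : BondConfig (Fin n)) := by
    rintro o ho y (⟨-, h⟩ | ⟨h, -⟩)
    · exact h o (Sym2.mem_mk_left o y) ho
    · exact hNS o (h o (Sym2.mem_mk_left o y)) ho
  -- hence a vertex of `S` is joined to no other vertex in `Ψ_N ω`
  have hiso : ∀ o ∈ S, ∀ v : Fin n, v ≠ o → ({e | e ∈ ω ∧ ∀ y ∈ e, y ∉ S} ∪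
      {e | (∀ y ∈ e, y ∈ N) ∧ ¬ e.IsDiag} : BondConfig (Fin n)) ∉ openConn v o := by
    intro o ho v hv h
    obtain ⟨z, -, hz, -⟩ := goodBase_exists_open_pair (SimpleGraph.Reachable.symm h) hv
    exact hstar o ho z hz
  -- the reach of a vertex `z ∉ S`
  have hkey : ∀ z : Fin n, z ∉ S →
      ((ω ∈ ⋃ v ∈ S, openConn v z) ↔
        ({e | e ∈ ω ∧ ∀ y ∈ e, y ∉ S} ∪ {e | (∀ y ∈ e, y ∈ N) ∧ ¬ e.IsDiag} :
            BondConfig (Fin n)) ∈ ⋃ v ∈ N, openConn v z) := by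
    intro z hz
    have h := h1 {z} (Finset.disjoint_singleton_right.2 hz)
    simpa only [Finset.set_biUnion_singleton] using h
  constructor
  · intro h z
    by_cases hz : z ∈ S
    · refine iff_of_false (fun hzW => Finset.disjoint_left.1 hWS hzW hz) ?_
      simp only [Set.mem_iUnion, exists_prop, not_exists, not_and]
      intro v hv
      exact hiso z hz v fun hvz => hNS v hv (hvz ▸ hz)
    · rw [← hkey z hz, ← h z, Finset.mem_union]
      exact ⟨fun h => Or.inl h, fun h => h.elim id fun h => absurd h hz⟩
  · intro h z
    by_cases hz : z ∈ S
    · refine iff_of_true (Finset.mem_union_right W hz) ?_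
      exact Set.mem_iUnion₂.2 ⟨z, hz, SimpleGraph.Reachable.refl _⟩
    · rw [Finset.mem_union, hkey z hz, ← h z]
      exact ⟨fun h => h.elim id fun h => absurd h hz, fun h => Or.inl h⟩

/-- **Isolated vertices are free to forbid.**  Under a weighting vanishing on every star of `S`,
`μ(x ↔ b in Wᶜ) = μ(x ↔ b in (W ∪ S)ᶜ)` for `x ∉ S` (iterate `goodStep24_real_openConnIn_insert` over `S`).
[folklore] -/
theorem wbP_real_openConnIn_union (K : Sym2 (Fin n) → unitInterval) (S W : Finset (Fin n)) (x b : Fin n)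
    (hK : ∀ o ∈ S, ∀ z : Fin n, K s(o, z) = 0) (hx : x ∉ S) :
    (prodBernoulli K).real (openConnIn ((W : Set (Fin n))ᶜ) x b) =
      (prodBernoulli K).real (openConnIn ((↑(W ∪ S) : Set (Fin n))ᶜ) x b) := by
  induction S using Finset.induction_on with
  | empty => rw [Finset.union_empty]
  | @insert o S hoS ih =>
    rw [ih (fun o' ho' => hK o' (Finset.mem_insert_of_mem ho')) (fun h => hx (Finset.mem_insert_of_mem h)),
      Finset.union_insert]
    exact goodStep24_real_openConnIn_insert K o x b (W ∪ S) (hK o (Finset.mem_insert_self o S))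
      fun h => hx (h ▸ Finset.mem_insert_self o S)

/-- **The whole-block σ-identity P, abstract form.**  `p` is the glued weighting, `L N` the layer events of the
block `S` (partitioning the space, `hpart`), `K` the conull clique event (`hKc`), `Ψ N` the delete-stars-of-`S`/glue-`N`
map with law `q N` on `L N` (`hlaw`) and the cluster geometry `hgeo` on `L N ∩ K` (`wbP_geometry`); `q N` kills the
stars of `S` (`hqS`) and agrees with `p` on the pairs avoiding any `W ⊇ S ∪ N` (`hqW`).  Then the dead-pocket sum with
worst selection of the block `S` under `p` is the `L`-average of the dead-pocket sums of the blocks `N` under `q N`: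
swap the sums, re-index the pockets by `W' = W ∖ S` (pockets `W ⊉ S` on the left are empty, pockets `W'` meeting `S`
on the right are null, `goodStep24_block_null`), factor the layer (`hlaw` + `hgeo` inside the conull `K`,
`sigmaRec_inter_congr`) and identify the factors (`prodBernoulli_real_eq_of_determinedBy` on the pairs avoiding
`W' ∪ S`, `wbP_real_openConnIn_union` for the isolated vertices of `S`). [cite: KozmaNitzan2024, §3.2 pp. 13–14] -/
theorem wbP_engine (p : Sym2 (Fin n) → unitInterval)
    (q : Finset (Fin n) → Sym2 (Fin n) → unitInterval)
    (L : Finset (Fin n) → Set (BondConfig (Fin n)))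
    (Ψ : Finset (Fin n) → BondConfig (Fin n) → BondConfig (Fin n))
    (K : Set (BondConfig (Fin n)))
    (A S : Finset (Fin n)) (b : Fin n) (hb : b ∈ A) (hSA : Disjoint S A)
    (hKc : prodBernoulli p Kᶜ = 0)
    (hpart : ∀ F : Set (BondConfig (Fin n)),
      (prodBernoulli p).real F = ∑ N : Finset (Fin n), (prodBernoulli p).real (L N ∩ F))
    (hlaw : ∀ (N : Finset (Fin n)) (E : Set (BondConfig (Fin n))),
      (prodBernoulli p).real (L N ∩ {ω | Ψ N ω ∈ E}) =
        (prodBernoulli p).real (L N) * (prodBernoulli (q N)).real E)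
    (hgeo : ∀ (N W : Finset (Fin n)) (ω : BondConfig (Fin n)), ω ∈ L N → ω ∈ K → Disjoint W S →
      ((∀ z : Fin n, (z ∈ W ∪ S ↔ ω ∈ ⋃ v ∈ S, openConn v z)) ↔
        ∀ z : Fin n, (z ∈ W ↔ Ψ N ω ∈ ⋃ v ∈ N, openConn v z)))
    (hLS : ∀ N : Finset (Fin n), (prodBernoulli p).real (L N) ≠ 0 → Disjoint N S)
    (hqS : ∀ N : Finset (Fin n), Disjoint N S → ∀ o ∈ S, ∀ z : Fin n, q N s(o, z) = 0)
    (hqW : ∀ N W : Finset (Fin n), S ⊆ W → N ⊆ W →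
      ∀ e ∈ ((W : Set (Fin n))ᶜ).sym2, p e = q N e) :
    (∑ W ∈ (Finset.univ : Finset (Finset (Fin n))).filter (fun W => Disjoint W A),
        (prodBernoulli p).real
            {ω : BondConfig (Fin n) | ∀ z : Fin n, (z ∈ W ↔ ω ∈ ⋃ v ∈ S, openConn v z)}
          * A.inf' ⟨b, hb⟩ (fun a => (prodBernoulli p).real (openConnIn ((W : Set (Fin n))ᶜ) a b)))
      = ∑ N : Finset (Fin n), (prodBernoulli p).real (L N) *
          (∑ W ∈ (Finset.univ : Finset (Finset (Fin n))).filter (fun W => Disjoint W A),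
            (prodBernoulli (q N)).real
                {ω : BondConfig (Fin n) | ∀ z : Fin n, (z ∈ W ↔ ω ∈ ⋃ v ∈ N, openConn v z)}
              * A.inf' ⟨b, hb⟩ (fun a => (prodBernoulli (q N)).real (openConnIn ((W : Set (Fin n))ᶜ) a b))) := by
  symm
  -- the identity layer by layer
  have hN : ∀ N : Finset (Fin n), (prodBernoulli p).real (L N) *
      (∑ W ∈ (Finset.univ : Finset (Finset (Fin n))).filter (fun W => Disjoint W A),
        (prodBernoulli (q N)).real
            {ω : BondConfig (Fin n) | ∀ z : Fin n, (z ∈ W ↔ ω ∈ ⋃ v ∈ N, openConn v z)}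
          * A.inf' ⟨b, hb⟩ (fun a => (prodBernoulli (q N)).real (openConnIn ((W : Set (Fin n))ᶜ) a b))) =
      ∑ W ∈ (Finset.univ : Finset (Finset (Fin n))).filter (fun W => Disjoint W A),
        (prodBernoulli p).real (L N ∩
            {ω : BondConfig (Fin n) | ∀ z : Fin n, (z ∈ W ↔ ω ∈ ⋃ v ∈ S, openConn v z)})
          * A.inf' ⟨b, hb⟩ (fun a => (prodBernoulli p).real (openConnIn ((W : Set (Fin n))ᶜ) a b)) := by
    intro N
    rw [Finset.mul_sum]
    refine Eq.trans (Finset.sum_filter_of_ne (p := fun W => Disjoint W S) fun W _ hne => ?_).symm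
      (Eq.trans ?_ (Finset.sum_filter_of_ne (p := fun W => S ⊆ W) fun W _ hne => ?_))
    · -- pockets `W` meeting `S` are null under `q N` (or the layer is null)
      by_contra hWS
      apply hne
      rcases eq_or_ne ((prodBernoulli p).real (L N)) 0 with h0 | h0
      · rw [h0, zero_mul]
      · obtain ⟨o, hoW, hoS⟩ := Finset.not_disjoint_iff.1 hWS
        have hNS : Disjoint N S := hLS N h0
        rw [goodStep24_block_null (q N) o N W (hqS N hNS o hoS)
          (fun h => Finset.disjoint_left.1 hNS h hoS) hoW, zero_mul, mul_zero]
    · -- re-index `W = W' ∪ S`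
      refine Finset.sum_nbij' (fun W => W ∪ S) (fun W => W \ S) ?_ ?_ ?_ ?_ ?_
      · intro W hW
        simp only [Finset.mem_filter, Finset.mem_univ, true_and] at hW ⊢
        exact ⟨Finset.disjoint_union_left.2 ⟨hW.1, hSA⟩, Finset.subset_union_right⟩
      · intro W hW
        simp only [Finset.mem_filter, Finset.mem_univ, true_and] at hW ⊢
        exact ⟨Finset.disjoint_of_subset_left Finset.sdiff_subset hW.1, Finset.sdiff_disjoint⟩
      · intro W hW
        simp only [Finset.mem_filter, Finset.mem_univ, true_and] at hW
        exact Finset.union_sdiff_cancel_right hW.2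
      · intro W hW
        simp only [Finset.mem_filter, Finset.mem_univ, true_and] at hW
        exact Finset.sdiff_union_of_subset hW.2
      · intro W hW
        simp only [Finset.mem_filter, Finset.mem_univ, true_and] at hW
        obtain ⟨hWA, hWS⟩ := hW
        -- the layer factorises (law + geometry inside the conull clique event)
        have hfac : (prodBernoulli p).real (L N ∩
            {ω : BondConfig (Fin n) | ∀ z : Fin n, (z ∈ W ∪ S ↔ ω ∈ ⋃ v ∈ S, openConn v z)}) =
            (prodBernoulli p).real (L N) * (prodBernoulli (q N)).real
              {ω : BondConfig (Fin n) | ∀ z : Fin n, (z ∈ W ↔ ω ∈ ⋃ v ∈ N, openConn v z)} := by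
          rw [← hlaw N]
          exact sigmaRec_inter_congr p hKc fun ω hLω hKω => hgeo N W ω hLω hKω hWS
        rw [hfac, mul_assoc]
        rcases eq_or_ne ((prodBernoulli p).real (L N)) 0 with hL0 | hL0
        · rw [hL0, zero_mul, zero_mul]
        rcases eq_or_ne ((prodBernoulli (q N)).real
            {ω : BondConfig (Fin n) | ∀ z : Fin n, (z ∈ W ↔ ω ∈ ⋃ v ∈ N, openConn v z)}) 0 with hK0 | hK0
        · rw [hK0, zero_mul, zero_mul]
        have hNS : Disjoint N S := hLS N hL0
        have hNW : N ⊆ W := by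
          by_contra hc
          exact hK0 (by rw [wbP_pocket_eq_empty N W hc, measureReal_empty])
        -- the worst-selection factors agree on the relays
        have hinf : A.inf' ⟨b, hb⟩ (fun a => (prodBernoulli (q N)).real (openConnIn ((W : Set (Fin n))ᶜ) a b)) =
            A.inf' ⟨b, hb⟩ (fun a => (prodBernoulli p).real (openConnIn ((↑(W ∪ S) : Set (Fin n))ᶜ) a b)) := by
          refine Finset.inf'_congr _ rfl fun a ha => ?_
          have haS : a ∉ S := fun h => Finset.disjoint_left.1 hSA h ha
          rw [wbP_real_openConnIn_union (q N) S W a b (hqS N hNS) haS]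
          exact (prodBernoulli_real_eq_of_determinedBy p (q N)
            (hqW N (W ∪ S) Finset.subset_union_right (hNW.trans Finset.subset_union_left))
            (DCT16.determinedBy_openConnIn _ a b subset_rfl) MeasurableSet.of_discrete).symm
        rw [hinf]
    · -- pockets `W ⊉ S` of the block are empty
      by_contra hSW
      apply hne
      rw [wbP_pocket_eq_empty S W hSW, Set.inter_empty, measureReal_empty, zero_mul]
  rw [Finset.sum_congr rfl fun N _ => hN N, Finset.sum_comm]
  refine Finset.sum_congr rfl fun W _ => ?_
  rw [← Finset.sum_mul, ← hpart]

end WholeBlockPockets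

/-- Registered stub `stub_wholeBlockPockets_c5` of crux stmt-CriticalPhenomena-4576 (line `peel`, skeleton v7,
whole-block route of lead c5): **the whole-block σ-identity P** ("dead pockets with worst selection", hub = the whole
glued block `S`) — the dead-pocket sum with worst selection of the glued block `S` under `μ_{u/S}` is the average,
over the layer `N` of `S` (the outside vertices joined to `S` by an open pair), of the dead-pocket sums of the blocks
`N` under the weighting `q_N` (every star of `S` killed, `N` glued):
`Σ_{W ∩ A = ∅} μ_{u/S}(K_S = W) · min_A μ_{u/S}(· ↔ b in Wᶜ)`
`  = Σ_N μ_{u/S}(layer of S = N) · Σ_{W ∩ A = ∅} μ_{q_N}(K_N = W) · min_A μ_{q_N}(· ↔ b in Wᶜ)`.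
Instance of `wbP_engine` with `stub_sigmaLaw` / `stub_sigmaGeometry` at `O = S` and the conull clique event of `S`
(`sigmaRec_conull`). [cite: KozmaNitzan2024, §3.2 pp. 13–14 (the `σ_B`-decomposition)] -/
theorem stub_wholeBlockPockets_c5 :
    ∀ (n : ℕ) (u : Sym2 (Fin n) → unitInterval) (A S : Finset (Fin n)) (b : Fin n) (hb : b ∈ A), Disjoint S A →
      (∑ W ∈ (Finset.univ : Finset (Finset (Fin n))).filter (fun W => Disjoint W A),
              (prodBernoulli (fun e : Sym2 (Fin n) => if (∀ y ∈ e, y ∈ S) ∧ ¬ e.IsDiag then 1 else u e)).real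
                  {ω : BondConfig (Fin n) | ∀ z : Fin n, (z ∈ W ↔ ω ∈ ⋃ v ∈ S, openConn v z)}
                * A.inf' ⟨b, hb⟩ (fun a => (prodBernoulli (fun e : Sym2 (Fin n) => if (∀ y ∈ e, y ∈ S) ∧ ¬ e.IsDiag then 1 else u e)).real (openConnIn ((W : Set (Fin n))ᶜ) a b)))
        = ∑ N : Finset (Fin n), (prodBernoulli (fun e : Sym2 (Fin n) => if (∀ y ∈ e, y ∈ S) ∧ ¬ e.IsDiag then 1 else u e)).real {ω : BondConfig (Fin n) | ∀ y : Fin n, y ∈ N ↔ (y ∉ S ∧ ∃ o ∈ S, s(o, y) ∈ ω)}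
            * (∑ W ∈ (Finset.univ : Finset (Finset (Fin n))).filter (fun W => Disjoint W A),
              (prodBernoulli (fun e : Sym2 (Fin n) => if (∀ y ∈ e, y ∈ N) ∧ ¬ e.IsDiag then 1 else if (∃ y ∈ e, y ∈ S) then 0 else u e)).real
                  {ω : BondConfig (Fin n) | ∀ z : Fin n, (z ∈ W ↔ ω ∈ ⋃ v ∈ N, openConn v z)}
                * A.inf' ⟨b, hb⟩ (fun a => (prodBernoulli (fun e : Sym2 (Fin n) => if (∀ y ∈ e, y ∈ N) ∧ ¬ e.IsDiag then 1 else if (∃ y ∈ e, y ∈ S) then 0 else u e)).real (openConnIn ((W : Set (Fin n))ᶜ) a b))) := by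
  intro n u A S b hb hSA
  refine wbP_engine (fun e : Sym2 (Fin n) => if (∀ y ∈ e, y ∈ S) ∧ ¬ e.IsDiag then 1 else u e)
    (fun (N : Finset (Fin n)) (e : Sym2 (Fin n)) =>
      if (∀ y ∈ e, y ∈ N) ∧ ¬ e.IsDiag then 1 else if (∃ y ∈ e, y ∈ S) then 0 else u e)
    (fun N : Finset (Fin n) =>
      {ω : BondConfig (Fin n) | ∀ y : Fin n, y ∈ N ↔ (y ∉ S ∧ ∃ o ∈ S, s(o, y) ∈ ω)})
    (fun (N : Finset (Fin n)) (ω : BondConfig (Fin n)) =>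
      ({e | e ∈ ω ∧ ∀ y ∈ e, y ∉ S} ∪ {e | (∀ y ∈ e, y ∈ N) ∧ ¬ e.IsDiag} : BondConfig (Fin n)))
    {ω : BondConfig (Fin n) | ∀ o ∈ S, ∀ o' ∈ S, o ≠ o' → s(o, o') ∈ ω}
    A S b hb hSA ?_ ?_ ?_ ?_ ?_ ?_ ?_
  · -- the clique event of the glued block is conull (weight `1` on the non-loop pairs inside `S`)
    refine sigmaRec_conull _ _ fun ω hω => ?_
    simp only [Set.mem_setOf_eq] at hω
    push Not at hω
    obtain ⟨o, ho, o', ho', hne, hnot⟩ := hω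
    refine ⟨s(o, o'), ?_, hnot⟩
    show (if (∀ y ∈ s(o, o'), y ∈ S) ∧ ¬ (s(o, o')).IsDiag then (1 : unitInterval) else u s(o, o')) = 1
    rw [if_pos]
    refine ⟨fun y hy => ?_, fun hd => hne (Sym2.mk_isDiag_iff.1 hd)⟩
    rcases Sym2.mem_iff.1 hy with rfl | rfl
    · exact ho
    · exact ho'
  · exact fun F => sigmaRec_partition _ S F
  · intro N E
    exact stub_sigmaLaw n u S N E
  · intro N W ω hL hK hWS
    exact wbP_geometry S N W hWS ω hL hK
  · intro N hN
    by_contra hNS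
    obtain ⟨y, hyN, hyS⟩ := Finset.not_disjoint_iff.1 hNS
    apply hN
    rw [Set.eq_empty_of_forall_notMem (s := {ω : BondConfig (Fin n) | ∀ y : Fin n, y ∈ N ↔
        (y ∉ S ∧ ∃ o ∈ S, s(o, y) ∈ ω)}) fun ω hω => ((hω y).1 hyN).1 hyS, measureReal_empty]
  · intro N hNS o ho z
    have h1 : ¬ ((∀ y ∈ s(o, z), y ∈ N) ∧ ¬ (s(o, z)).IsDiag) := by
      rintro ⟨h, -⟩
      exact Finset.disjoint_left.1 hNS (h o (Sym2.mem_mk_left o z)) ho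
    have h2 : ∃ y ∈ s(o, z), y ∈ S := ⟨o, Sym2.mem_mk_left o z, ho⟩
    rw [if_neg h1, if_pos h2]
  · intro N W hSW hNW e he
    obtain ⟨y, hy⟩ : ∃ y, y ∈ e := ⟨e.out.1, Sym2.out_fst_mem e⟩
    have hmem : ∀ v ∈ e, v ∉ W := fun v hv hvW => Set.mem_sym2_iff_subset.1 he hv (Finset.mem_coe.2 hvW)
    have h1 : ¬ ((∀ v ∈ e, v ∈ S) ∧ ¬ e.IsDiag) := by
      rintro ⟨h, -⟩
      exact hmem y hy (hSW (h y hy))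
    have h2 : ¬ ((∀ v ∈ e, v ∈ N) ∧ ¬ e.IsDiag) := by
      rintro ⟨h, -⟩
      exact hmem y hy (hNW (h y hy))
    have h3 : ¬ (∃ v ∈ e, v ∈ S) := by
      rintro ⟨v, hv, hvS⟩
      exact hmem v hv (hSW hvS)
    rw [if_neg h1, if_neg h2, if_neg h3]

end

end Summit.CriticalPhenomena.PercolationContinuityZ3.Theorems
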